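/- Copyright: the b2b-balaban cell (near-miss cell 7), T⁴-continuum fan-out, lineage t4-ne7b-p1 (node U5c COUNT
member).  Released under the licence of the surrounding project. -/
import Summits.QuantumFields.BalabanUV.T4Continuum.Support.HistoryGenealogyRealiseOrder

/-!
# Touch-components of a finite family of domains (H3-(ID), geometric half; brick 2 of M3b-2 «instantiation from the
level sets»): print's «components» of a large-field region as a finset PARTITION of the vertex set of the touch graph,
each block connected in b02's sense `GConn` — so each block has a leaf-first `ChainTouch` enumeration (owner module of
row NE7b, lineage `t4-ne7b-p1` gen 40, ruling R-OWNER-40-4; re-open object (α), `SCOPE-alpha.md` v2.2 §5 row M3b-2 —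
PRE-POSITIONING ONLY)

Summits-side support leaf of the T⁴-continuum cell (rung (B)+1 on a FINITE torus only; NOT infinite volume, NOT the
mass gap, NOT the Clay statement; NOT a proof of the spine estimate NE7b, which is the cell's OWN estimate, NOT PRINTED
and NOT PROVED).  [folklore] finite graph combinatorics over b02's `B16MergeGeometry.touchGraph`∕`fam` and
`Step.Budget.GConn`, Mathlib `SimpleGraph.Reachable`, and row S14's `exists_chainTouch_enum_of_gconn`; nothing printed is
asserted, no `def … : Prop` fact of Bałaban's, no cite-tagged hypothesis, zero `sorry`.  B16 = [Balaban1989LargeFieldII]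
pp. 383∕386 is a manuscript UNDER AUDIT; «components of Z_j» (p. 386: «Denote the components of Z_j by Z_j^{(n)}»)
is the only locator (C-B16-6).

WHY.  The instantiation M3b-2 defines print's process level by level: the components of `Z_{j+1}` are the
TOUCH-COMPONENTS of the family «S-images of the surviving components of `Z_j`» ∪ «new regions of level `j+1`», each
component's constituent list a leaf-first enumeration of its block, its domain the union of the block's images.  This
file supplies the partition into blocks and, per block, connectedness (`GConn`) — hence the enumeration (row S14's
ORDER module) — and the disjointness of the blocks' unions (distinct components do not even touch).

WHAT IS DEFINED AND PROVED.  `LinkedIn P S i j` (a chain of touch-graph edges with all vertices in `S`), its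
reflexivity∕symmetry∕transitivity and `S`-closure; **`tcomp P S i`** (the block of `i`: the members of `S` linked to
`i`), `mem_tcomp_self`, `tcomp_subset`, **`tcomp_eq_of_mem`** (blocks of linked vertices coincide), **`tcomp_eq_or_disjoint`**;
**`tcomps P S`** (the finset of blocks), `mem_tcomps_iff`, **`tcomps_biUnion`** (the blocks cover `S`), `tcomps_nonempty_of_mem`,
**`gconn_tcomp`** (each block is `GConn (touchGraph P)` — a walk in the induced graph along the chain),
**`exists_chainTouch_enum_tcomp`** (each block has a duplicate-free leaf-first enumeration), **`fam_disjoint_of_ne`** (the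
unions of the images over two distinct blocks are DISJOINT — a shared cube would link the owners), `not_touch_of_ne`
(they do not even touch), `fam_tcomp_nonempty`.  §2 sanity (`ℤ¹`): three unit domains `{0}, {1}, {5}` have the two
blocks `{0,1}`-owners and the `{5}`-owner.

HONEST.  Proves nothing of Bałaban's; NE7b NOT proved; spine 0∕9.  HONEST DEPENDENCY (cell): continuum YM on T⁴ ⇐
BetaPertH ∧ nine spine estimates (0/9 proved); BetaPertH ⇐ (D1) ∧ (D4) ∧ CAP+tail; G-an2-4 gates asym, D1 and NE2/3/4.
This file changes none of it. -/

open Finset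
open Literature.MathematicalPhysics.QuantumFieldTheory.Balaban1983to89
open Literature.MathematicalPhysics.QuantumFieldTheory.Balaban1983to89.B13ScaleTransfer
open Literature.MathematicalPhysics.QuantumFieldTheory.Balaban1983to89.B16MergeGeometry
open Literature.MathematicalPhysics.QuantumFieldTheory.Balaban1983to89.Step.Budget

namespace Summit.QuantumFields.BalabanUV.T4Continuum.HistoryTouchComponents

open HistoryGenealogyRealise

noncomputable section

open Classical

/-! ## §1 Blocks of the touch graph induced on a finite vertex set -/

variable {d : ℕ} {ι : Type*} (P : ι → Finset (Pt d)) (S : Finset ι)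

/-- one touch-graph edge with both ends in `S` [folklore] -/
def StepIn (a b : ι) : Prop := a ∈ S ∧ b ∈ S ∧ (touchGraph P).Adj a b

/-- **linked inside `S`**: a chain of touch-graph edges all of whose vertices lie in `S` [folklore] -/
def LinkedIn (i j : ι) : Prop := Relation.ReflTransGen (StepIn P S) i j

variable {P S}

/-- a step is symmetric [folklore] -/
theorem StepIn.symm {a b : ι} (h : StepIn P S a b) : StepIn P S b a := ⟨h.2.1, h.1, h.2.2.symm⟩

/-- linked is reflexive [folklore] -/
theorem LinkedIn.refl (i : ι) : LinkedIn P S i i := Relation.ReflTransGen.refl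

/-- linked is transitive [folklore] -/
theorem LinkedIn.trans {i j k : ι} (h₁ : LinkedIn P S i j) (h₂ : LinkedIn P S j k) : LinkedIn P S i k :=
  Relation.ReflTransGen.trans h₁ h₂

/-- linked is symmetric [folklore] -/
theorem LinkedIn.symm {i j : ι} (h : LinkedIn P S i j) : LinkedIn P S j i := by
  induction h with
  | refl => exact LinkedIn.refl i
  | tail _ hbc ih => exact (Relation.ReflTransGen.single hbc.symm).trans ih

/-- a vertex linked to another by a NON-trivial chain's end lies in `S`; in general: linked from a member of `S` ⇒
member of `S` [folklore] -/
theorem LinkedIn.mem {i j : ι} (h : LinkedIn P S i j) (hi : i ∈ S) : j ∈ S := by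
  induction h with
  | refl => exact hi
  | tail _ hbc _ => exact hbc.2.1

variable (P S)

/-- **THE BLOCK of `i`**: the members of `S` linked to `i` inside `S` (print's «component» containing `i`). [folklore] -/
def tcomp (i : ι) : Finset ι := S.filter fun j => LinkedIn P S i j

/-- **THE BLOCKS** of `S`. [folklore] -/
def tcomps : Finset (Finset ι) := S.image (tcomp P S)

variable {P S}

/-- membership in a block [folklore] -/
theorem mem_tcomp_iff {i j : ι} : j ∈ tcomp P S i ↔ j ∈ S ∧ LinkedIn P S i j := by
  simp [tcomp]

/-- a member of `S` lies in its own block [folklore] -/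
theorem mem_tcomp_self {i : ι} (hi : i ∈ S) : i ∈ tcomp P S i := mem_tcomp_iff.2 ⟨hi, LinkedIn.refl i⟩

/-- blocks are subsets of `S` [folklore] -/
theorem tcomp_subset (i : ι) : tcomp P S i ⊆ S := Finset.filter_subset _ _

/-- **blocks of linked vertices coincide** [folklore] -/
theorem tcomp_eq_of_mem {i j : ι} (hj : j ∈ tcomp P S i) : tcomp P S j = tcomp P S i := by
  obtain ⟨-, hij⟩ := mem_tcomp_iff.1 hj
  ext k
  simp only [mem_tcomp_iff]
  exact ⟨fun ⟨hk, hjk⟩ => ⟨hk, hij.trans hjk⟩, fun ⟨hk, hik⟩ => ⟨hk, hij.symm.trans hik⟩⟩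

/-- **two blocks are equal or disjoint** [folklore] -/
theorem tcomp_eq_or_disjoint (i j : ι) : tcomp P S i = tcomp P S j ∨ Disjoint (tcomp P S i) (tcomp P S j) := by
  by_cases h : Disjoint (tcomp P S i) (tcomp P S j)
  · exact Or.inr h
  · left
    obtain ⟨k, hki, hkj⟩ := Finset.not_disjoint_iff.1 h
    rw [← tcomp_eq_of_mem hki, tcomp_eq_of_mem hkj]

/-- membership in the set of blocks [folklore] -/
theorem mem_tcomps_iff {T : Finset ι} : T ∈ tcomps P S ↔ ∃ i ∈ S, tcomp P S i = T := by
  simp [tcomps]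

/-- blocks are subsets of `S` [folklore] -/
theorem subset_of_mem_tcomps {T : Finset ι} (hT : T ∈ tcomps P S) : T ⊆ S := by
  obtain ⟨i, -, rfl⟩ := mem_tcomps_iff.1 hT
  exact tcomp_subset i

/-- blocks are nonempty [folklore] -/
theorem nonempty_of_mem_tcomps {T : Finset ι} (hT : T ∈ tcomps P S) : T.Nonempty := by
  obtain ⟨i, hi, rfl⟩ := mem_tcomps_iff.1 hT
  exact ⟨i, mem_tcomp_self hi⟩

/-- **the blocks cover `S`** [folklore] -/
theorem tcomps_biUnion : (tcomps P S).biUnion id = S := by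
  ext j
  simp only [Finset.mem_biUnion, id, mem_tcomps_iff]
  constructor
  · rintro ⟨T, ⟨i, -, rfl⟩, hj⟩
    exact tcomp_subset i hj
  · intro hj
    exact ⟨tcomp P S j, ⟨j, hj, rfl⟩, mem_tcomp_self hj⟩

/-- the block of a member is a block [folklore] -/
theorem tcomp_mem_tcomps {i : ι} (hi : i ∈ S) : tcomp P S i ∈ tcomps P S := mem_tcomps_iff.2 ⟨i, hi, rfl⟩

/-- a member of `S` lies in exactly the block `tcomp P S j` among the blocks [folklore] -/
theorem eq_tcomp_of_mem_of_mem_tcomps {T : Finset ι} (hT : T ∈ tcomps P S) {j : ι} (hj : j ∈ T) : T = tcomp P S j := by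
  obtain ⟨i, -, rfl⟩ := mem_tcomps_iff.1 hT
  exact (tcomp_eq_of_mem hj).symm

/-- **distinct blocks are disjoint** [folklore] -/
theorem disjoint_of_ne {T T' : Finset ι} (hT : T ∈ tcomps P S) (hT' : T' ∈ tcomps P S) (hne : T ≠ T') :
    Disjoint T T' := by
  obtain ⟨i, -, rfl⟩ := mem_tcomps_iff.1 hT
  obtain ⟨i', -, rfl⟩ := mem_tcomps_iff.1 hT'
  exact (tcomp_eq_or_disjoint i i').resolve_left hne

/-- **EACH BLOCK IS CONNECTED in b02's sense**: the touch graph induced on `tcomp P S i` is connected (`i ∈ S`) — a walk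
along the linking chain, all of whose vertices lie in the block. [folklore] -/
theorem gconn_tcomp {i : ι} (hi : i ∈ S) : GConn (touchGraph P) (tcomp P S i) := by
  have hiT : i ∈ tcomp P S i := mem_tcomp_self hi
  -- reachability from `i` to every vertex linked to it, inside the induced graph on the block
  have key : ∀ j, LinkedIn P S i j → ∃ hj : j ∈ tcomp P S i,
      ((touchGraph P).induce (↑(tcomp P S i) : Set ι)).Reachable ⟨i, Finset.mem_coe.2 hiT⟩ ⟨j, Finset.mem_coe.2 hj⟩ := by
    intro j h
    induction h with
    | refl => exact ⟨hiT, SimpleGraph.Reachable.refl _⟩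
    | tail hab hbc ih =>
        obtain ⟨hb, hreach⟩ := ih
        have hc : _ ∈ tcomp P S i := mem_tcomp_iff.2 ⟨hbc.2.1, hab.tail hbc⟩
        exact ⟨hc, hreach.trans (SimpleGraph.Adj.reachable (SimpleGraph.induce_adj.2 hbc.2.2))⟩
  unfold GConn
  haveI : Nonempty (↑(tcomp P S i) : Set ι) := ⟨⟨i, Finset.mem_coe.2 hiT⟩⟩
  refine SimpleGraph.Connected.mk fun u v => ?_
  obtain ⟨_hu', hu⟩ := key u.1 (mem_tcomp_iff.1 (Finset.mem_coe.1 u.2)).2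
  obtain ⟨_hv', hv⟩ := key v.1 (mem_tcomp_iff.1 (Finset.mem_coe.1 v.2)).2
  exact SimpleGraph.Reachable.trans (SimpleGraph.Reachable.symm hu) hv

/-- every block is `GConn` [folklore] -/
theorem gconn_of_mem_tcomps {T : Finset ι} (hT : T ∈ tcomps P S) : GConn (touchGraph P) T := by
  obtain ⟨i, hi, rfl⟩ := mem_tcomps_iff.1 hT
  exact gconn_tcomp hi

/-- **EACH BLOCK HAS A LEAF-FIRST ENUMERATION** (row S14's greedy order on a connected touch graph). [folklore] -/
theorem exists_chainTouch_enum_of_mem_tcomps {T : Finset ι} (hT : T ∈ tcomps P S) :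
    ∃ l : List ι, l.Nodup ∧ l.toFinset = T ∧ ChainTouch (l.map P) :=
  exists_chainTouch_enum_of_gconn P (gconn_of_mem_tcomps hT)

/-- owners of touching cubes in `S` are linked [folklore] -/
theorem linkedIn_of_touch {i j : ι} (hi : i ∈ S) (hj : j ∈ S) {a c : Pt d} (ha : a ∈ P i) (hc : c ∈ P j)
    (hac : Touch a c) : LinkedIn P S i j := by
  by_cases hij : i = j
  · subst hij; exact LinkedIn.refl i
  · exact Relation.ReflTransGen.single ⟨hi, hj, (touchGraph_adj P i j).2 ⟨hij, a, ha, c, hc, hac⟩⟩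

/-- **DISTINCT BLOCKS DO NOT TOUCH**: no cube of the union over one block touches a cube of the union over another.
[folklore] -/
theorem not_touch_of_ne {T T' : Finset ι} (hT : T ∈ tcomps P S) (hT' : T' ∈ tcomps P S) (hne : T ≠ T')
    {a c : Pt d} (ha : a ∈ fam P T) (hc : c ∈ fam P T') : ¬ Touch a c := by
  intro hac
  obtain ⟨i, hi, hai⟩ := mem_fam.1 ha
  obtain ⟨j, hj, hcj⟩ := mem_fam.1 hc
  have hl : LinkedIn P S i j := linkedIn_of_touch (subset_of_mem_tcomps hT hi) (subset_of_mem_tcomps hT' hj) hai hcj hac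
  have hjT : j ∈ T := by
    rw [eq_tcomp_of_mem_of_mem_tcomps hT hi]
    exact mem_tcomp_iff.2 ⟨subset_of_mem_tcomps hT' hj, hl⟩
  exact Finset.disjoint_left.1 (disjoint_of_ne hT hT' hne) hjT hj

/-- **THE UNIONS OVER DISTINCT BLOCKS ARE DISJOINT** (a shared cube touches itself). [folklore] -/
theorem fam_disjoint_of_ne {T T' : Finset ι} (hT : T ∈ tcomps P S) (hT' : T' ∈ tcomps P S) (hne : T ≠ T') :
    Disjoint (fam P T) (fam P T') :=
  Finset.disjoint_left.2 fun a ha ha' => not_touch_of_ne hT hT' hne ha ha' (Touch.refl a)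

/-- the union over a block is nonempty if every member domain is [folklore] -/
theorem fam_nonempty_of_mem_tcomps {T : Finset ι} (hT : T ∈ tcomps P S) (hP : ∀ i ∈ S, (P i).Nonempty) :
    (fam P T).Nonempty := by
  obtain ⟨i, hi⟩ := nonempty_of_mem_tcomps hT
  obtain ⟨x, hx⟩ := hP i (subset_of_mem_tcomps hT hi)
  exact ⟨x, mem_fam.2 ⟨i, hi, hx⟩⟩

/-- hence distinct blocks have DIFFERENT unions [folklore] -/
theorem fam_ne_of_ne {T T' : Finset ι} (hT : T ∈ tcomps P S) (hT' : T' ∈ tcomps P S) (hne : T ≠ T')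
    (hP : ∀ i ∈ S, (P i).Nonempty) : fam P T ≠ fam P T' := by
  intro h
  obtain ⟨x, hx⟩ := fam_nonempty_of_mem_tcomps hT hP
  exact Finset.disjoint_left.1 (fam_disjoint_of_ne hT hT' hne) hx (h ▸ hx)

/-! ## §2 Sanity (`ℤ¹`): `{0}, {1}` form one block, `{5}` another -/

namespace Sanity

open B16MergeGeometry.OneDim

/-- three unit domains in `ℤ¹` indexed by `Fin 3` [folklore] -/
def P3' : Fin 3 → Finset (Pt 1) := ![{pt 0}, {pt 1}, {pt 5}]

/-- `0` and `1` are linked (their cubes touch) [folklore] -/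
example : LinkedIn P3' Finset.univ 0 1 :=
  linkedIn_of_touch (Finset.mem_univ _) (Finset.mem_univ _) (a := pt 0) (c := pt 1) (by simp [P3'])
    (by simp [P3']) (fun _ => by simp only [pt]; omega)

/-- `{0}` and `{5}` do not touch, so `0` and `2` are not adjacent [folklore] -/
example : ¬ (touchGraph P3').Adj 0 2 := by
  rintro ⟨-, a, ha, c, hc, hac⟩
  simp only [P3', Matrix.cons_val_zero] at ha
  have hc' : c = pt 5 := by simpa [P3'] using hc
  rw [Finset.mem_singleton] at ha
  subst ha; subst hc'
  have := (hac 0).2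
  simp [pt] at this

end Sanity

end

end Summit.QuantumFields.BalabanUV.T4Continuum.HistoryTouchComponents
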